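import Literature.Geometry.Lorentzian.ParametricAnnulusGluingKIDRigidity
import Literature.Geometry.Lorentzian.KIDChartJetRigidity
import HarnessLib

/-!
# `ChruscielDelay_parametricAnnulusGluing`: the second proof of the jet rigidity `(J)`

Topic `Literature/Geometry/Lorentzian`. Everything here is PROVED; no definition, no statement of
`Prop` type is introduced.

Two independent proofs of the one-jet rigidity of Killing initial data landed in the same commit
batch: `KIDJetRigidity.lean` (`KIDJetRigidity.eqOn_zero_of_isPreconnected`) with the reduction
file `ParametricAnnulusGluingKIDRigidity.lean` (`kidJetRigidity`, `kidExhaustion`,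
`ChruscielDelay_parametricAnnulusGluing_of_compactCore`), and `KIDChartJetRigidity.lean`
(`MetricCoord.IsMetricOn.kid_eq_zero_of_oneJet_eq_zero`) with this file. To keep one name per
statement in the library, this file no longer restates `kidJetRigidity`, `kidExhaustion` and
`ChruscielDelay_parametricAnnulusGluing_of_compactCore` (use those of
`ParametricAnnulusGluingKIDRigidity.lean`, imported here); it records the second route to `(J)` in
the slightly more general preconnected form:

* `kidJetRigidity_of_isPreconnected` — on a preconnected open `V ⊆ E3` carrying smooth Riemannian
  coordinate vacuum data, a smooth KID whose one-jet vanishes at one point of `V` vanishes on `V`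
  (through `MetricCoord.IsMetricOn.kid_eq_zero_of_oneJet_eq_zero`: the prolongation bounds
  `‖D²N‖, ‖D²X‖ ≤ C (|N| + ‖DN‖ + ‖X‖ + ‖DX‖)` and Grönwall propagation of the jet
  `u = (N, DN, X, DX)`). Moncrief 1975, §III; Beig–Chruściel 1997, §2.

The state of the named fact `ChruscielDelay_parametricAnnulusGluing` (`ParametricAnnulusGluing.lean`)
is unchanged: it follows from the single explicit hypothesis `(E)` of
`ChruscielDelay_parametricAnnulusGluing_of_compactCore` — the one-parameter Chruściel–Delay theorem
(2003, Thm. 5.9, Prop. 5.10, Cor. 5.11, §8.6) for smooth coordinate vacuum data on a compact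
annulus of `E3`, weighted elliptic theory not available in the tree.

## References

* V. Moncrief, J. Math. Phys. 16 (1975) 493–498, §III. [Moncrief1975]
* R. Beig, P. T. Chruściel, Class. Quantum Grav. 14 (1997) A83–A92, §2. [BeigChrusciel1997]
* P. T. Chruściel, E. Delay, Mém. Soc. Math. Fr. 94 (2003), Thm. 5.9, Prop. 5.10, Cor. 5.11,
  §8.6. [ChruscielDelay2003]
-/

noncomputable section

set_option maxSynthPendingDepth 3

open Set Function Filter TopologicalSpace Module Metric
open scoped ContDiff Topology

namespace Literature.Geometry.Lorentzian

/-- **Jet rigidity of KIDs on preconnected coordinate domains of `E3`** (second proof of `(J)`,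
cf. `kidJetRigidity`): on a preconnected open `V ⊆ E3` with smooth Riemannian coordinate data
`(G, K)` satisfying the vacuum constraints, a smooth KID `(N, Y)` whose one-jet `(N, dN, Y, DY)`
vanishes at one point of `V` vanishes on `V` (`MetricCoord.IsMetricOn.kid_eq_zero_of_oneJet_eq_zero`
in dimension `3`). Moncrief 1975, §III; Beig–Chruściel 1997, §2. [cite: Moncrief1975, §III] -/
theorem kidJetRigidity_of_isPreconnected {ι : Type} [Fintype ι] (b₀ : Basis ι ℝ E3) :
    ∀ (V : Set E3), IsOpen V → IsPreconnected V →
      ∀ (G K : E3 → E3 →L[ℝ] E3 →L[ℝ] ℝ), ContDiffOn ℝ ∞ G V → ContDiffOn ℝ ∞ K V →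
        (∀ z ∈ V, ∀ v w : E3, G z v w = G z w v ∧ K z v w = K z w v) →
        (∀ z ∈ V, ∀ v : E3, v ≠ 0 → 0 < G z v v) →
        (∀ z ∈ V, MetricCoord.hamAt G K z = 0 ∧ ∀ Z : E3, MetricCoord.momFn b₀ G K z Z = 0) →
        ∀ (N : E3 → ℝ) (Y : E3 → E3), ContDiffOn ℝ ∞ N V → ContDiffOn ℝ ∞ Y V →
          (∀ z ∈ V, MetricCoord.adjHamG G K N z + MetricCoord.adjMomGS G K Y z = 0 ∧
            MetricCoord.adjHamK G K N z + MetricCoord.adjMomKS G Y z = 0) →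
          ∀ z₀ ∈ V, N z₀ = 0 → fderiv ℝ N z₀ = 0 → Y z₀ = 0 → fderiv ℝ Y z₀ = 0 →
            ∀ z ∈ V, N z = 0 ∧ Y z = 0 := by
  intro V hVo hVc G K hGs hKs hsym hpos hcv N Y hN hY hk z₀ hz₀ h₁ h₂ h₃ h₄
  have hG : MetricCoord.IsMetricOn G V :=
    MetricCoord.isMetricOn_of_pos hVo hGs (fun z hz v w ↦ (hsym z hz v w).1) hpos
  have hn : Module.finrank ℝ E3 ≠ 1 := by
    rw [finrank_euclideanSpace_fin]
    norm_num
  exact hG.kid_eq_zero_of_oneJet_eq_zero b₀ hVc hn hKs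
    (fun z hz v w ↦ (hsym z hz v w).2) hcv hN hY hk hz₀ h₁ h₂ h₃ h₄

/-- The connected form `(J)` through the second route (it is `kidJetRigidity` of
`ParametricAnnulusGluingKIDRigidity.lean`, re-derived from `kidJetRigidity_of_isPreconnected`).
[cite: Moncrief1975, §III] -/
example {ι : Type} [Fintype ι] (b₀ : Basis ι ℝ E3) :
    ∀ (V : Set E3), IsOpen V → IsConnected V →
      ∀ (G K : E3 → E3 →L[ℝ] E3 →L[ℝ] ℝ), ContDiffOn ℝ ∞ G V → ContDiffOn ℝ ∞ K V →
        (∀ z ∈ V, ∀ v w : E3, G z v w = G z w v ∧ K z v w = K z w v) →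
        (∀ z ∈ V, ∀ v : E3, v ≠ 0 → 0 < G z v v) →
        (∀ z ∈ V, MetricCoord.hamAt G K z = 0 ∧ ∀ Z : E3, MetricCoord.momFn b₀ G K z Z = 0) →
        ∀ (N : E3 → ℝ) (Y : E3 → E3), ContDiffOn ℝ ∞ N V → ContDiffOn ℝ ∞ Y V →
          (∀ z ∈ V, MetricCoord.adjHamG G K N z + MetricCoord.adjMomGS G K Y z = 0 ∧
            MetricCoord.adjHamK G K N z + MetricCoord.adjMomKS G Y z = 0) →
          ∀ z₀ ∈ V, N z₀ = 0 → fderiv ℝ N z₀ = 0 → Y z₀ = 0 → fderiv ℝ Y z₀ = 0 →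
            ∀ z ∈ V, N z = 0 ∧ Y z = 0 :=
  fun V hVo hVc ↦ kidJetRigidity_of_isPreconnected b₀ V hVo hVc.isPreconnected

end Literature.Geometry.Lorentzian

end
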